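import Mathlib
import HarnessLib
import Literature.MathematicalPhysics.QuantumFieldTheory.YangMillsOS
import Literature.MathematicalPhysics.QuantumFieldTheory.LatticeGaugeProofs
import Literature.MathematicalPhysics.QuantumFieldTheory.LatticeGaugeStaticPotentialProofs
import Summits.QuantumFields.YangMills.Theorems.FemtoCurvatureTwoPoint.Negative.PlaquetteFreezing

/-!
# Crux `FemtoCurvatureTwoPoint` (stmt-QuantumFields-9363, route `LangevinControlUV`), line
`generic-step-gamma-encoding`: the a-priori Cauchy–Schwarz ceiling for plaquette covariances

Support lemma for the all-pairs stubs (`stub_pairGaussianUpper`, GD⁺; `stub_pairUpper`, K2⁺) of the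
line: on every torus `(ℤ/L)⁴`, for every coupling `β`, every compact `G` and every continuous
matrix representation `ρ`, the covariance of two plaquette fields
`P_x^{ij} = N - Re tr ρ(U_{p(x;i,j)})` is bounded by the variance of ONE plaquette field:

* `abs_plaquetteCov_le_plaquetteVar` —
  `|Cov_{L,β}(P_x^{ij}, P_y^{i'j'})| ≤ Var_{L,β}(P_0^{01})`, all `x, y, i, j, i', j'`.

Ingredients: Cauchy–Schwarz for covariances (`abs_cov_le_sqrt_mul_sqrt`), and the torus symmetries
of Wilson's state — translations (`wilsonExpectation_comp_torusConfigShift`) and coordinate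
permutations (`wilsonExpectation_comp_configPerm`) — under which every genuine plaquette field
`P_x^{ij}`, `i ≠ j`, has the law of `P_0^{01}` (`wilsonExpectation_fun_plaquetteField_eq`); the
degenerate fields `P_x^{ii}` vanish identically. This is the "hard ceiling `|Cov| ≤ Var P`" used by
the crux's refutation notes (`Cruxes/FemtoCurvatureTwoPoint/DREFUTE-gsge-stub-pairUpper.md`, §B(1)):
together with any bound `β² Var_{L,β}(P) ≤ V` it makes the sup functional
`max_{pairs} β² |Cov| dist⁸ ≤ V L⁸` finite on each fixed torus.
-/

noncomputable section

open scoped BigOperators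
open MeasureTheory ProbabilityTheory Filter Topology
open Literature.MathematicalPhysics.QuantumFieldTheory

namespace Summit.QuantumFields.YangMills.Theorems.FemtoCurvatureTwoPoint

/-! ### Cauchy–Schwarz for covariances -/

/-- **Cauchy–Schwarz for the covariance**, moment form: for square-integrable `X`, `Y` on a
probability space, `|E[XY] - E[X] E[Y]| ≤ √(E[X²] - E[X]²) · √(E[Y²] - E[Y]²)`.
-- adapted from `Summit.AtomisticToContinuum.HydrodynamicLimit.Theorems.AmplitudeTransfer.abs_integral_sub_mul_sub_le` -/
theorem abs_cov_le_sqrt_mul_sqrt {Ω : Type*} [MeasurableSpace Ω] {μ : Measure Ω}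
    [IsProbabilityMeasure μ] {X Y : Ω → ℝ} (hX : MemLp X 2 μ) (hY : MemLp Y 2 μ) :
    |(∫ ω, X ω * Y ω ∂μ) - (∫ ω, X ω ∂μ) * (∫ ω, Y ω ∂μ)| ≤
      Real.sqrt ((∫ ω, X ω ^ 2 ∂μ) - (∫ ω, X ω ∂μ) ^ 2) *
        Real.sqrt ((∫ ω, Y ω ^ 2 ∂μ) - (∫ ω, Y ω ∂μ) ^ 2) := by
  -- rewrite both sides through Mathlib's `covariance` / `variance`
  have hcov : (∫ ω, X ω * Y ω ∂μ) - (∫ ω, X ω ∂μ) * (∫ ω, Y ω ∂μ) = cov[X, Y; μ] := by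
    rw [covariance_eq_sub hX hY]; rfl
  have hvarX : (∫ ω, X ω ^ 2 ∂μ) - (∫ ω, X ω ∂μ) ^ 2 = Var[X; μ] := by
    rw [variance_eq_sub hX]; rfl
  have hvarY : (∫ ω, Y ω ^ 2 ∂μ) - (∫ ω, Y ω ∂μ) ^ 2 = Var[Y; μ] := by
    rw [variance_eq_sub hY]; rfl
  rw [hcov, hvarX, hvarY, covariance]
  set f : Ω → ℝ := fun ω => X ω - ∫ ω', X ω' ∂μ with hf
  set g : Ω → ℝ := fun ω => Y ω - ∫ ω', Y ω' ∂μ with hg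
  have hfL : MemLp f 2 μ := hX.sub (memLp_const _)
  have hgL : MemLp g 2 μ := hY.sub (memLp_const _)
  have hfa : MemLp (fun ω => |f ω|) (ENNReal.ofReal 2) μ := by
    rw [ENNReal.ofReal_ofNat]; exact hfL.abs
  have hga : MemLp (fun ω => |g ω|) (ENNReal.ofReal 2) μ := by
    rw [ENNReal.ofReal_ofNat]; exact hgL.abs
  have hH := integral_mul_le_Lp_mul_Lq_of_nonneg Real.HolderConjugate.two_two
    (Eventually.of_forall fun ω => abs_nonneg (f ω)) (Eventually.of_forall fun ω => abs_nonneg (g ω))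
    hfa hga
  have hvarX' : Var[X; μ] = ∫ ω, |f ω| ^ (2 : ℝ) ∂μ := by
    rw [variance_eq_integral hX.1.aemeasurable]
    refine integral_congr_ae (Eventually.of_forall fun ω => ?_)
    simp only [hf, Real.rpow_two, sq_abs]
  have hvarY' : Var[Y; μ] = ∫ ω, |g ω| ^ (2 : ℝ) ∂μ := by
    rw [variance_eq_integral hY.1.aemeasurable]
    refine integral_congr_ae (Eventually.of_forall fun ω => ?_)
    simp only [hg, Real.rpow_two, sq_abs]
  calc |∫ ω, (X ω - ∫ ω', X ω' ∂μ) * (Y ω - ∫ ω', Y ω' ∂μ) ∂μ|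
      = |∫ ω, f ω * g ω ∂μ| := rfl
    _ ≤ ∫ ω, |f ω * g ω| ∂μ := abs_integral_le_integral_abs
    _ = ∫ ω, |f ω| * |g ω| ∂μ := by simp_rw [abs_mul]
    _ ≤ (∫ ω, |f ω| ^ (2 : ℝ) ∂μ) ^ (1 / (2 : ℝ)) * (∫ ω, |g ω| ^ (2 : ℝ) ∂μ) ^ (1 / (2 : ℝ)) := hH
    _ = Real.sqrt (Var[X; μ]) * Real.sqrt (Var[Y; μ]) := by
        rw [Real.sqrt_eq_rpow, Real.sqrt_eq_rpow, hvarX', hvarY']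

/-- The moment form of the variance is non-negative: `E[X]² ≤ E[X²]` for square-integrable `X` on a
probability space. -/
theorem sq_integral_le_integral_sq {Ω : Type*} [MeasurableSpace Ω] {μ : Measure Ω}
    [IsProbabilityMeasure μ] {X : Ω → ℝ} (hX : MemLp X 2 μ) :
    (∫ ω, X ω ∂μ) ^ 2 ≤ ∫ ω, X ω ^ 2 ∂μ := by
  have h : (∫ ω, X ω ^ 2 ∂μ) - (∫ ω, X ω ∂μ) ^ 2 = Var[X; μ] := by
    rw [variance_eq_sub hX]; rfl
  have := variance_nonneg X μ
  linarith

/-! ### Plaquette fields: symmetry and integrability -/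

variable {G : Type} [Group G] [TopologicalSpace G] [IsTopologicalGroup G] [CompactSpace G]
  [MeasurableSpace G] [BorelSpace G] {N : ℕ} (ρ : G →* Matrix (Fin N) (Fin N) ℂ)

/-- For distinct coordinate directions `i ≠ j` of `Fin 4` there is a permutation of the axes
sending `0 ↦ i` and `1 ↦ j`. -/
theorem exists_perm_apply_zero_one {i j : Fin 4} (hij : i ≠ j) :
    ∃ π : Equiv.Perm (Fin 4), π 0 = i ∧ π 1 = j := by
  refine ⟨(Equiv.swap (0 : Fin 4) i).trans (Equiv.swap (Equiv.swap (0 : Fin 4) i 1) j), ?_, ?_⟩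
  · simp only [Equiv.trans_apply, Equiv.swap_apply_left]
    refine Equiv.swap_apply_of_ne_of_ne ?_ hij
    intro h
    have h' : Equiv.swap (0 : Fin 4) i 0 = Equiv.swap (0 : Fin 4) i 1 := by
      rw [Equiv.swap_apply_left]; exact h
    exact absurd ((Equiv.swap (0 : Fin 4) i).injective h') (by decide)
  · simp only [Equiv.trans_apply, Equiv.swap_apply_left]

omit [TopologicalSpace G] [IsTopologicalGroup G] [CompactSpace G] [MeasurableSpace G]
  [BorelSpace G] in
/-- The degenerate plaquette field vanishes: `N - Re tr ρ(U_{p(x;i,i)}) = 0`. -/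
theorem plaquetteField_self {L : ℕ} (U : GaugeConfig 4 L G) (x : Site 4 L) (i : Fin 4) :
    (N : ℝ) - (ρ (plaquetteHolonomy U x i i)).trace.re = 0 := by
  simp [plaquetteHolonomy_self, Matrix.trace_one]

/-- **Every genuine plaquette field has the law of `P_0^{01}`** (as seen by Wilson expectations):
for `i ≠ j`, every `x` and every `φ : ℝ → ℝ`,
`⟨φ(P_x^{ij})⟩_{L,β} = ⟨φ(P_0^{01})⟩_{L,β}` — translate `x` to the origin
(`wilsonExpectation_comp_torusConfigShift`) and permute the axes `(i, j) ↦ (0, 1)`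
(`wilsonExpectation_comp_configPerm`). -/
theorem wilsonExpectation_fun_plaquetteField_eq (hρ : Continuous ρ) {L : ℕ} [NeZero L] (β : ℝ)
    (φ : ℝ → ℝ) (x : Site 4 L) {i j : Fin 4} (hij : i ≠ j) :
    wilsonExpectation ρ β (fun U : GaugeConfig 4 L G =>
        φ ((N : ℝ) - (ρ (plaquetteHolonomy U x i j)).trace.re)) =
      wilsonExpectation ρ β (fun U : GaugeConfig 4 L G =>
        φ ((N : ℝ) - (ρ (plaquetteHolonomy U 0 0 1)).trace.re)) := by
  -- translation `x ↦ 0`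
  have h1 : wilsonExpectation ρ β (fun U : GaugeConfig 4 L G =>
        φ ((N : ℝ) - (ρ (plaquetteHolonomy U x i j)).trace.re)) =
      wilsonExpectation ρ β (fun U : GaugeConfig 4 L G =>
        φ ((N : ℝ) - (ρ (plaquetteHolonomy U 0 i j)).trace.re)) := by
    have key := wilsonExpectation_comp_torusConfigShift (d := 4) (L := L) ρ β (-x)
      (fun U : GaugeConfig 4 L G => φ ((N : ℝ) - (ρ (plaquetteHolonomy U 0 i j)).trace.re))
    refine Eq.trans ?_ key
    congr 1
    funext U
    simp only [Function.comp_apply, plaquetteHolonomy_torusConfigShift, sub_neg_eq_add, zero_add]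
  -- axis permutation `(i, j) ↦ (0, 1)`
  obtain ⟨π, hπ0, hπ1⟩ := exists_perm_apply_zero_one hij
  have hi : π.symm i = 0 := by rw [Equiv.symm_apply_eq]; exact hπ0.symm
  have hj : π.symm j = 1 := by rw [Equiv.symm_apply_eq]; exact hπ1.symm
  have hs0 : sitePerm π.symm (0 : Site 4 L) = 0 := by
    funext k
    simp only [sitePerm_apply, Pi.zero_apply]
  have h2 : wilsonExpectation ρ β (fun U : GaugeConfig 4 L G =>
        φ ((N : ℝ) - (ρ (plaquetteHolonomy U 0 0 1)).trace.re)) =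
      wilsonExpectation ρ β (fun U : GaugeConfig 4 L G =>
        φ ((N : ℝ) - (ρ (plaquetteHolonomy U 0 i j)).trace.re)) := by
    have key := wilsonExpectation_comp_configPerm (d := 4) (L := L) ρ hρ β π
      (fun U : GaugeConfig 4 L G => φ ((N : ℝ) - (ρ (plaquetteHolonomy U 0 i j)).trace.re))
    refine Eq.trans ?_ key
    congr 1
    funext U
    simp only [Function.comp_apply, plaquetteHolonomy_configPerm, hi, hj, hs0]
  rw [h1, h2]

variable [SecondCountableTopology G]

/-- Plaquette fields are square-integrable under Wilson's measure (continuous on a compact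
second-countable configuration space, finite measure). -/
theorem memLp_plaquetteField (hρ : Continuous ρ) {L : ℕ} [NeZero L] (β : ℝ) (x : Site 4 L)
    (i j : Fin 4) :
    MemLp (fun U : GaugeConfig 4 L G => (N : ℝ) - (ρ (plaquetteHolonomy U x i j)).trace.re) 2
      (wilsonMeasure ρ β) := by
  haveI := isProbabilityMeasure_wilsonMeasure (d := 4) (L := L) ρ hρ β
  have hcont := Negative.PlaquetteFreezing.continuous_plaquetteField ρ hρ x i j
  obtain ⟨C, hC⟩ := isCompact_univ.exists_bound_of_continuousOn hcont.continuousOn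
  exact MemLp.of_bound hcont.aestronglyMeasurable C
    (Eventually.of_forall fun U => hC U (Set.mem_univ U))

/-- **The Cauchy–Schwarz ceiling for plaquette covariances.** For every compact second-countable
`G`, continuous `ρ`, torus `(ℤ/L)⁴`, coupling `β`, sites `x, y` and directions `i, j, i', j'`:
`|⟨P_x^{ij} P_y^{i'j'}⟩ - ⟨P_x^{ij}⟩⟨P_y^{i'j'}⟩| ≤ ⟨(P_0^{01})²⟩ - ⟨P_0^{01}⟩²`
(`P_x^{ij} = N - Re tr ρ(U_{p(x;i,j)})`; the degenerate fields `i = j` vanish identically). -/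
theorem abs_plaquetteCov_le_plaquetteVar (hρ : Continuous ρ) {L : ℕ} [NeZero L] (β : ℝ)
    (x y : Site 4 L) (i j i' j' : Fin 4) :
    |wilsonExpectation ρ β (fun U : GaugeConfig 4 L G =>
          ((N : ℝ) - (ρ (plaquetteHolonomy U x i j)).trace.re) *
            ((N : ℝ) - (ρ (plaquetteHolonomy U y i' j')).trace.re))
        - wilsonExpectation ρ β (fun U : GaugeConfig 4 L G =>
            (N : ℝ) - (ρ (plaquetteHolonomy U x i j)).trace.re)
          * wilsonExpectation ρ β (fun U : GaugeConfig 4 L G =>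
            (N : ℝ) - (ρ (plaquetteHolonomy U y i' j')).trace.re)|
      ≤ wilsonExpectation ρ β (fun U : GaugeConfig 4 L G =>
            ((N : ℝ) - (ρ (plaquetteHolonomy U 0 0 1)).trace.re) ^ 2)
          - (wilsonExpectation ρ β (fun U : GaugeConfig 4 L G =>
              (N : ℝ) - (ρ (plaquetteHolonomy U 0 0 1)).trace.re)) ^ 2 := by
  haveI := isProbabilityMeasure_wilsonMeasure (d := 4) (L := L) ρ hρ β
  -- the variance of `P_0^{01}` in moment form is non-negative
  have hV0 : 0 ≤ wilsonExpectation ρ β (fun U : GaugeConfig 4 L G =>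
            ((N : ℝ) - (ρ (plaquetteHolonomy U 0 0 1)).trace.re) ^ 2)
          - (wilsonExpectation ρ β (fun U : GaugeConfig 4 L G =>
              (N : ℝ) - (ρ (plaquetteHolonomy U 0 0 1)).trace.re)) ^ 2 := by
    have := sq_integral_le_integral_sq (memLp_plaquetteField ρ hρ β (0 : Site 4 L) 0 1)
    simp only [wilsonExpectation]
    linarith
  -- degenerate planes: the field vanishes identically
  by_cases hij : i = j
  · subst hij
    simpa [plaquetteField_self, wilsonExpectation] using hV0
  by_cases hi'j' : i' = j'
  · subst hi'j'
    simpa [plaquetteField_self, wilsonExpectation] using hV0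
  -- genuine planes: Cauchy–Schwarz, then both variances equal `Var(P_0^{01})`
  have hX := memLp_plaquetteField ρ hρ β x i j
  have hY := memLp_plaquetteField ρ hρ β y i' j'
  have hCS := abs_cov_le_sqrt_mul_sqrt hX hY
  have hX2 := wilsonExpectation_fun_plaquetteField_eq ρ hρ β (fun t => t ^ 2) x hij
  have hX1 := wilsonExpectation_fun_plaquetteField_eq ρ hρ β (fun t => t) x hij
  have hY2 := wilsonExpectation_fun_plaquetteField_eq ρ hρ β (fun t => t ^ 2) y hi'j'
  have hY1 := wilsonExpectation_fun_plaquetteField_eq ρ hρ β (fun t => t) y hi'j'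
  simp only [wilsonExpectation] at hX2 hX1 hY2 hY1 hV0 ⊢
  have hVX : (∫ U, ((N : ℝ) - (ρ (plaquetteHolonomy U x i j)).trace.re) ^ 2 ∂wilsonMeasure ρ β)
      - (∫ U, (N : ℝ) - (ρ (plaquetteHolonomy U x i j)).trace.re ∂wilsonMeasure ρ β) ^ 2 =
      (∫ U, ((N : ℝ) - (ρ (plaquetteHolonomy U (0 : Site 4 L) 0 1)).trace.re) ^ 2 ∂wilsonMeasure ρ β)
      - (∫ U, (N : ℝ) - (ρ (plaquetteHolonomy U (0 : Site 4 L) 0 1)).trace.re ∂wilsonMeasure ρ β) ^ 2 := by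
    rw [hX2, hX1]
  have hVY : (∫ U, ((N : ℝ) - (ρ (plaquetteHolonomy U y i' j')).trace.re) ^ 2 ∂wilsonMeasure ρ β)
      - (∫ U, (N : ℝ) - (ρ (plaquetteHolonomy U y i' j')).trace.re ∂wilsonMeasure ρ β) ^ 2 =
      (∫ U, ((N : ℝ) - (ρ (plaquetteHolonomy U (0 : Site 4 L) 0 1)).trace.re) ^ 2 ∂wilsonMeasure ρ β)
      - (∫ U, (N : ℝ) - (ρ (plaquetteHolonomy U (0 : Site 4 L) 0 1)).trace.re ∂wilsonMeasure ρ β) ^ 2 := by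
    rw [hY2, hY1]
  rw [hVX, hVY, Real.mul_self_sqrt hV0] at hCS
  exact hCS

end Summit.QuantumFields.YangMills.Theorems.FemtoCurvatureTwoPoint

namespace Summit.QuantumFields.YangMills.Theorems.FemtoCurvatureTwoPoint

/-- **The Cauchy–Schwarz ceiling for a faithful lattice representation `r`** (registered support
stub `abs_plaquetteCov_le_plaquetteVar_rep` of item stmt-QuantumFields-9363, signature verbatim;
second countability is automatic for `r : LatticeRep G`): in the notation of the line's stubs,
`|Cov_{L,β}(P_x^{ij}, P_y^{i'j'})| ≤ Var_{L,β}(P_0^{01})` for all `β`, `L`, `x, y, i, j, i', j'`. -/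
theorem abs_plaquetteCov_le_plaquetteVar_rep :
    ∀ (G : Type) [Group G] [TopologicalSpace G] [IsTopologicalGroup G] [CompactSpace G]
      [MeasurableSpace G] [BorelSpace G] (r : LatticeRep G) (L : ℕ) [NeZero L] (β : ℝ)
      (x y : Fin 4 → ZMod L) (i j i' j' : Fin 4),
      |wilsonExpectation r.ρ β (fun U : GaugeConfig 4 L G =>
            ((r.N : ℝ) - (r.ρ (plaquetteHolonomy U x i j)).trace.re) *
              ((r.N : ℝ) - (r.ρ (plaquetteHolonomy U y i' j')).trace.re))
          - wilsonExpectation r.ρ β (fun U : GaugeConfig 4 L G =>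
              (r.N : ℝ) - (r.ρ (plaquetteHolonomy U x i j)).trace.re)
            * wilsonExpectation r.ρ β (fun U : GaugeConfig 4 L G =>
              (r.N : ℝ) - (r.ρ (plaquetteHolonomy U y i' j')).trace.re)|
        ≤ wilsonExpectation r.ρ β (fun U : GaugeConfig 4 L G =>
              ((r.N : ℝ) - (r.ρ (plaquetteHolonomy U 0 0 1)).trace.re) ^ 2)
            - (wilsonExpectation r.ρ β (fun U : GaugeConfig 4 L G =>
                (r.N : ℝ) - (r.ρ (plaquetteHolonomy U 0 0 1)).trace.re)) ^ 2 := by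
  intro G _ _ _ _ _ _ r L _ β x y i j i' j'
  haveI : SecondCountableTopology G :=
    Summit.QuantumFields.YangMills.Theorems.TunedSequenceExists.Negative.Freezing.secondCountable_of_latticeRep r
  exact abs_plaquetteCov_le_plaquetteVar r.ρ r.continuous β x y i j i' j'

end Summit.QuantumFields.YangMills.Theorems.FemtoCurvatureTwoPoint

end
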